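import Summits.QuantumFields.YangMills.Theorems.DiagonalMirrorRPRWilsonDiagonalModelBlockChain
import Summits.QuantumFields.YangMills.Theorems.DiagonalMirrorRPRWilsonDiagonalModelChainSplit

/-!
# Crux `WeakCouplingHypercubicLimitRP` (stmt-QuantumFields-27398) / aside `DiagonalMirrorRPR` (stmt-QuantumFields-10604), door B, R1-side
# supply chain of D1′ (`stub_oddTorusSwapPairingLiminf`), item (ii) step 1: the BLOCK FACTORISATION of the reflected two-point insertion
# WITH A GAP (the second observable shifted by `s` layers)

Helper file (`--supports stmt-QuantumFields-27398 --as helper`) of the hand `hand-10604-wilsonDiagModel-2` g3 (docket director-ym g24, O4 WORD 47 (2) /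
48 (1): item (ii) — the identification of the lead's pinned `swapShiftPairing` (✓ `…TwoShiftProbesPinnedDefs`) with the half-configuration cyclic chain,
ending in the two-insertion spectral identity that the sandwich instance `twoShiftProbesAt` (hand-3, item (iv)) consumes); it closes nothing by itself.

WHAT.  Hand-2's `…BlockChain.integral_obsLR_mul_pairChain_eq` factorises `∫ Θf · f · (pair chain)` on `ℤ/mℤ` when the observable `f` (depth `e + 1`,
layers `1 … e+1`) sits NEXT to its swap reflection `Θf` (layers `0, −1, …, −e`).  Here the second observable `g` (same depth) is read `s` layers
further along the chain — on the SHIFTED string `t ↦ P (t + s)`, i.e. bond/in-slab layers `s+1, …, s+e+1` — so that between the mirror and `g` there is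
a GAP of `s` free bond layers.  On the chain of length `m = s + n + 2e + 2` the bond half layers then split into FOUR independent groups under the
product Haar measure: the gap `1 … s`, the direct block `s+1 … s+e+1`, the far arc `s+e+2 … s+e+1+n`, and the reflected block `0, −1, …, −e`:
* §1 index bookkeeping (the four groups are disjoint and exhaust `ℤ/mℤ`; integer labels in a window of length `< m`, hand-2's
  `int_eq_of_cast_zmod_eq`);
* §2 ★★ **`integral_obsL_mul_obsR_shift_mul_pairChain_eq`** (`β ≥ 0`, `ρ` continuous unitary, `|w(Y)_j| ≤ M`):
  `∫ Θf(P) · g(P(· + s)) · ∏_t e^{β even_t} e^{β odd_t} dP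
     = ∫ (∏_{j<s} 𝔟(V_j, V_{j+1})) (∏_{j<n} 𝔟(V_{s+e+1+j}, V_{s+e+2+j})) · halfBlock f (j ↦ V_{−j}) · halfBlock g (j ↦ V_{s+j}) dμ̃^{⊗ℤ/mℤ}(V)`
  — after `…ObservableChain` (lifted sites `V_t`, finite measure `μ̃`) the gap and the far arc integrate to reweighted lifted kernels `𝔟`, the block of
  `g` to `halfBlock g` on the sites `V_s … V_{s+e+1}`, and the block of `Θf` (substitution `Y ↦ ΘY`, reversal of the open links, hand-2) to `halfBlock f`
  on the reflected sites `V_0, V_{−1}, …, V_{−e−1}`.  At `s = 0`, `g = f` this is hand-2's statement; the gap is what makes the trace a TWO-insertion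
  trace `Tr(𝒯_f^† 𝔅^s 𝒯_g 𝔅^n)` (next files).

HONEST FRAMING: bookkeeping of the pairing layer for a shifted observable; no letter is proved; D1′ (`stub_oddTorusSwapPairingLiminf`), ⟨27398⟩ (0∕2),
S6i and the aside ⟨10604⟩ are OPEN; nothing here bears on the summit; the Yang–Mills mass gap is NOT proved here or anywhere in the tree.  No
definition, no instance, no notation, `autoImplicit false`.

References: K. Osterwalder, E. Seiler, Ann. Phys. 110 (1978) §2–3 (transfer matrix and reflection positivity for lattice gauge theories); E. Seiler,
LNP 159 (1982) Ch. 2.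
-/

set_option autoImplicit false

noncomputable section

open scoped BigOperators ENNReal
open MeasureTheory Function
open Literature.MathematicalPhysics.QuantumLattice Literature.MathematicalPhysics.QuantumFieldTheory
open Summit.QuantumFields.YangMills.Cruxes.DiagonalMirrorRPR.ParityBridgeColdTraces

namespace Summit.QuantumFields.YangMills.Cruxes.DiagonalMirrorRPR.SignTwistedDiagonalTrace.WilsonDiagonal

/-! ## §1 Index bookkeeping: gap, direct block, far arc, reflected block on `ℤ/mℤ`, `m = s + n + 2e + 2` -/

section Index

variable {m : ℕ}

/-- The four groups of bond layers — gap `1 … s`, far arc `s+e+2 … s+e+1+n`, reflected block `0, −1, …, −e`, direct block `s+1 … s+e+1` — as one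
map from the sum type; it is injective when `m = s + n + 2e + 2`. -/
theorem shiftedBondGroups_injective {s n e : ℕ} (hm : m = s + n + 2 * e + 2) :
    Function.Injective (Sum.elim
      (Sum.elim (fun j : Fin s => (((j : ℕ) + 1 : ℕ) : ZMod m)) (fun j : Fin n => ((s + e + 2 + (j : ℕ) : ℕ) : ZMod m)))
      (Sum.elim (fun i : Fin (e + 1) => -(((i : ℕ) : ℕ) : ZMod m)) (fun i : Fin (e + 1) => ((s + (i : ℕ) + 1 : ℕ) : ZMod m)))) := by
  -- integer labels in the window `[-e, s+e+1+n]` of length `< m`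
  set w : (Fin s ⊕ Fin n) ⊕ (Fin (e + 1) ⊕ Fin (e + 1)) → ℤ := Sum.elim
      (Sum.elim (fun j : Fin s => ((j : ℕ) : ℤ) + 1) (fun j : Fin n => (s : ℤ) + e + 2 + (j : ℕ)))
      (Sum.elim (fun i : Fin (e + 1) => -((i : ℕ) : ℤ)) (fun i : Fin (e + 1) => (s : ℤ) + (i : ℕ) + 1)) with hw
  have hcast : ∀ a, Sum.elim
      (Sum.elim (fun j : Fin s => (((j : ℕ) + 1 : ℕ) : ZMod m)) (fun j : Fin n => ((s + e + 2 + (j : ℕ) : ℕ) : ZMod m)))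
      (Sum.elim (fun i : Fin (e + 1) => -(((i : ℕ) : ℕ) : ZMod m)) (fun i : Fin (e + 1) => ((s + (i : ℕ) + 1 : ℕ) : ZMod m))) a =
      ((w a : ℤ) : ZMod m) := by
    intro a
    rcases a with (j | j) | (i | i) <;> simp only [hw, Sum.elim_inl, Sum.elim_inr] <;> push_cast <;> ring
  have hwin : ∀ a, -(e : ℤ) ≤ w a ∧ w a ≤ (s : ℤ) + e + 1 + n := by
    intro a
    rcases a with (j | j) | (i | i) <;> simp only [hw, Sum.elim_inl, Sum.elim_inr] <;> constructor <;> omega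
  intro a b h
  rw [hcast, hcast] at h
  have hab : w a = w b := by
    refine int_eq_of_cast_zmod_eq h ?_
    have ha := hwin a; have hb := hwin b
    rw [abs_lt]; constructor <;> omega
  rcases a with (j | j) | (i | i) <;> rcases b with (j' | j') | (i' | i') <;>
    simp only [hw, Sum.elim_inl, Sum.elim_inr] at hab <;>
    first
      | (simp only [Sum.inl.injEq, Sum.inr.injEq, Fin.ext_iff]; omega)
      | (exfalso; omega)

variable [NeZero m]

/-- The four groups exhaust the cycle. -/
theorem shiftedBondGroups_bijective {s n e : ℕ} (hm : m = s + n + 2 * e + 2) :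
    Function.Bijective (Sum.elim
      (Sum.elim (fun j : Fin s => (((j : ℕ) + 1 : ℕ) : ZMod m)) (fun j : Fin n => ((s + e + 2 + (j : ℕ) : ℕ) : ZMod m)))
      (Sum.elim (fun i : Fin (e + 1) => -(((i : ℕ) : ℕ) : ZMod m)) (fun i : Fin (e + 1) => ((s + (i : ℕ) + 1 : ℕ) : ZMod m)))) := by
  rw [Fintype.bijective_iff_injective_and_card]
  refine ⟨shiftedBondGroups_injective hm, ?_⟩
  simp only [Fintype.card_sum, Fintype.card_fin, ZMod.card]
  omega

end Index

/-! ## §2 ★★ The block factorisation with a gap -/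

section ShiftedBlockChain

variable {S : ℕ} [NeZero S] {G : Type} [Group G] {Nc : ℕ} (ρ : G →* Matrix (Fin Nc) (Fin Nc) ℂ)
variable [TopologicalSpace G] [IsTopologicalGroup G] [CompactSpace G] [MeasurableSpace G] [BorelSpace G]
  [SecondCountableTopology G]

omit [NeZero S] [Group G] [TopologicalSpace G] [IsTopologicalGroup G] [CompactSpace G] [BorelSpace G]
  [SecondCountableTopology G] in
/-- The observable read on a string is measurable in the string (bond layers read along an index map `a` through a measurable relabelling `θ` of the
half layer — the identity or the bond twist `Θ` —, in-slab layers along an index map `b`). -/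
theorem measurable_obs_read {m e : ℕ} {f : (Fin (e + 1) → HalfCfg S S G) → (Fin (e + 1) → HalfCfg S S G) → ℝ}
    (hf : Measurable (uncurry f)) (a b : Fin (e + 1) → ZMod m) {θ : HalfCfg S S G → HalfCfg S S G} (hθ : Measurable θ) :
    Measurable fun P : ZMod m → HalfCfg S S G × HalfCfg S S G => f (fun i => θ (P (a i)).1) (fun i => (P (b i)).2) :=
  hf.comp ((measurable_pi_lambda _ fun _ => hθ.comp (measurable_fst.comp (measurable_pi_apply _))).prodMk
    (measurable_pi_lambda _ fun _ => measurable_snd.comp (measurable_pi_apply _)))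

/-- ★★ **Block factorisation of the reflected two-point insertion with a gap of `s` layers** (`β ≥ 0`, `ρ` continuous unitary, `|w(Y)_j| ≤ M`,
chain length `m = s + n + 2e + 2`, observables `f, g` of depth `e + 1`, bounded and measurable; `g` read on the string shifted by `s`):
`∫ Θf(P) · g(P(· + s)) · ∏_t e^{β even_t} e^{β odd_t} dP
 = ∫ (∏_{j<s} 𝔟(V_j, V_{j+1})) · (∏_{j<n} 𝔟(V_{s+e+1+j}, V_{s+e+2+j})) · (halfBlock f (j ↦ V_{-j}) · halfBlock g (j ↦ V_{s+j})) dμ̃^{⊗ℤ/mℤ}(V)`. -/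
theorem integral_obsL_mul_obsR_shift_mul_pairChain_eq (hρ : Continuous ρ) {β : ℝ} (hβ : 0 ≤ β)
    (hρu : ∀ g, ρ g ∈ Matrix.unitaryGroup (Fin Nc) ℂ) {M : ℝ}
    (hM : ∀ (Y : HalfCfg S S G) (j : Fin (featDim S Nc)), |bondVec ρ Y j| ≤ M) {m s n e : ℕ} [NeZero m]
    (hm : m = s + n + 2 * e + 2) {f g : (Fin (e + 1) → HalfCfg S S G) → (Fin (e + 1) → HalfCfg S S G) → ℝ}
    (hf : Measurable (uncurry f)) (hg : Measurable (uncurry g)) {B : ℝ} (hBf : ∀ Y X, |f Y X| ≤ B) (hBg : ∀ Y X, |g Y X| ≤ B) :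
    ∫ P : ZMod m → HalfCfg S S G × HalfCfg S S G,
        obsL f P * obsR g (fun t => P (t + (s : ZMod m))) * ∏ t : ZMod m, Real.exp (β * evenActionU ρ (P t).1 (P t).2 (P (t + 1)).1) *
          Real.exp (β * oddActionU ρ (P t).2 (P (t + 1)).1 (P (t + 1)).2)
        ∂(Measure.pi fun _ : ZMod m => (halfHaar S G).prod (halfHaar S G)) =
      ∫ V : ZMod m → ℕ × HalfCfg S S G,
        (∏ j : Fin s, bKernel ρ β M (V (((j : ℕ) : ℕ) : ZMod m)) (V ((((j : ℕ) + 1 : ℕ)) : ZMod m))) *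
          (∏ j : Fin n, bKernel ρ β M (V ((s + e + 1 + (j : ℕ) : ℕ) : ZMod m)) (V ((s + e + 2 + (j : ℕ) : ℕ) : ZMod m))) *
          (halfBlock ρ β M f (fun j : Fin (e + 2) => V (-(((j : ℕ) : ℕ) : ZMod m))) *
            halfBlock ρ β M g (fun j : Fin (e + 2) => V ((s + (j : ℕ) : ℕ) : ZMod m)))
        ∂(Measure.pi fun _ => tMeasure S G Nc β M) := by
  haveI : IsProbabilityMeasure (halfHaar S G) := by unfold halfHaar; infer_instance
  -- the observable `Θf · g(· + s)` is bounded and measurable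
  have hB0 : 0 ≤ B := (abs_nonneg _).trans (hBf (fun _ _ => 1) (fun _ _ => 1))
  have hΩm : Measurable fun P : ZMod m → HalfCfg S S G × HalfCfg S S G => obsL f P * obsR g (fun t => P (t + (s : ZMod m))) := by
    refine Measurable.mul ?_ ?_
    · unfold obsL
      exact measurable_obs_read (S := S) (G := G) hf (fun i => -(((i : ℕ) : ℕ) : ZMod m))
        (fun i => -((((i : ℕ) + 1 : ℕ)) : ZMod m)) (continuous_thetaHalf (S := S) (G := G)).measurable
    · unfold obsR
      exact measurable_obs_read (S := S) (G := G) hg (fun i => ((((i : ℕ) + 1 : ℕ)) : ZMod m) + (s : ZMod m))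
        (fun i => ((((i : ℕ) + 1 : ℕ)) : ZMod m) + (s : ZMod m)) (measurable_id (α := HalfCfg S S G))
  have hΩb : ∀ P : ZMod m → HalfCfg S S G × HalfCfg S S G, |obsL f P * obsR g (fun t => P (t + (s : ZMod m)))| ≤ B * B := fun P => by
    rw [abs_mul]; exact mul_le_mul (hBf _ _) (hBg _ _) (abs_nonneg _) hB0
  rw [integral_obs_mul_pairChain_eq ρ hρ hβ hρu hM hΩm hΩb]
  refine integral_congr_ae (ae_of_all _ fun V => ?_)
  dsimp only
  -- notation for the four index maps and the open links along the cycle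
  set σG : Fin s → ZMod m := fun j => (((j : ℕ) + 1 : ℕ) : ZMod m) with hσG
  set σF : Fin n → ZMod m := fun j => ((s + e + 2 + (j : ℕ) : ℕ) : ZMod m) with hσF
  set σL : Fin (e + 1) → ZMod m := fun i => -(((i : ℕ) : ℕ) : ZMod m) with hσL
  set σR : Fin (e + 1) → ZMod m := fun i => ((s + (i : ℕ) + 1 : ℕ) : ZMod m) with hσR
  set gl : ZMod m → HalfCfg S S G → ℝ := fun t y => openLink ρ β M (V (t - 1)) (V t) y with hgl
  have hglm : ∀ t, Measurable (gl t) := fun t => (continuous_openLink_right ρ hρ β M _ _).measurable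
  have hbij := shiftedBondGroups_bijective (m := m) hm
  set ε : (Fin s ⊕ Fin n) ⊕ (Fin (e + 1) ⊕ Fin (e + 1)) ≃ ZMod m := Equiv.ofBijective _ hbij with hε
  -- the four-group split of the cyclic product of open links
  have hprod : ∀ Y : ZMod m → HalfCfg S S G, ∏ t, gl t (Y t) =
      ((∏ j, gl (σG j) (Y (σG j))) * ∏ j, gl (σF j) (Y (σF j))) * ((∏ i, gl (σL i) (Y (σL i))) * ∏ i, gl (σR i) (Y (σR i))) := by
    intro Y
    rw [← Fintype.prod_equiv ε (fun a => gl (ε a) (Y (ε a))) (fun t => gl t (Y t)) (fun a => rfl),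
      Fintype.prod_sum_type, Fintype.prod_sum_type, Fintype.prod_sum_type]
    rfl
  -- the four integrands
  set AG : (Fin s → HalfCfg S S G) → ℝ := fun y => ∏ j, gl (σG j) (y j) with hAG
  set AF : (Fin n → HalfCfg S S G) → ℝ := fun y => ∏ j, gl (σF j) (y j) with hAF
  set AL : (Fin (e + 1) → HalfCfg S S G) → ℝ := fun y =>
    (∏ i, gl (σL i) (y i)) * f (fun i => thetaHalf (y i)) (fun i => (V (-((((i : ℕ) + 1 : ℕ)) : ZMod m))).2) with hAL
  set AR : (Fin (e + 1) → HalfCfg S S G) → ℝ := fun y =>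
    (∏ i, gl (σR i) (y i)) * g y (fun i => (V (((((i : ℕ) + 1 : ℕ)) : ZMod m) + (s : ZMod m))).2) with hAR
  set A1 : (Fin s ⊕ Fin n → HalfCfg S S G) → ℝ := fun z => AG (fun j => z (Sum.inl j)) * AF (fun j => z (Sum.inr j)) with hA1
  set C : (Fin (e + 1) ⊕ Fin (e + 1) → HalfCfg S S G) → ℝ := fun z =>
    AL (fun i => z (Sum.inl i)) * AR (fun i => z (Sum.inr i)) with hC
  have hAGm : Measurable AG := Finset.measurable_prod _ fun j _ => (hglm _).comp (measurable_pi_apply j)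
  have hAFm : Measurable AF := Finset.measurable_prod _ fun j _ => (hglm _).comp (measurable_pi_apply j)
  have hALm : Measurable AL := by
    refine (Finset.measurable_prod _ fun i _ => (hglm _).comp (measurable_pi_apply i)).mul ?_
    exact hf.comp ((measurable_pi_lambda _ fun i => continuous_thetaHalf.measurable.comp (measurable_pi_apply i)).prodMk
      measurable_const)
  have hARm : Measurable AR :=
    (Finset.measurable_prod _ fun i _ => (hglm _).comp (measurable_pi_apply i)).mul (hg.comp (measurable_id.prodMk measurable_const))
  have hA1m : Measurable A1 :=
    (hAGm.comp (measurable_pi_lambda _ fun j => measurable_pi_apply _)).mul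
      (hAFm.comp (measurable_pi_lambda _ fun j => measurable_pi_apply _))
  have hCm : Measurable C :=
    (hALm.comp (measurable_pi_lambda _ fun i => measurable_pi_apply _)).mul
      (hARm.comp (measurable_pi_lambda _ fun i => measurable_pi_apply _))
  -- the shifted string reads the direct block
  have hσR' : ∀ i : Fin (e + 1), ((((i : ℕ) + 1 : ℕ)) : ZMod m) + (s : ZMod m) = σR i := fun i => by
    simp only [hσR]; push_cast; ring
  -- rewrite the integrand as `A1(Y∘σ₁) · C(Y∘σ₂)`
  have hint : ∀ Y : ZMod m → HalfCfg S S G,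
      (∏ t, openLink ρ β M (V (t - 1)) (V t) (Y t)) *
          (obsL f (fun t => (Y t, (V t).2)) * obsR g (fun t => (Y (t + (s : ZMod m)), (V (t + (s : ZMod m))).2))) =
        A1 (fun a => Y (Sum.elim σG σF a)) * C (fun c => Y (Sum.elim σL σR c)) := by
    intro Y
    have h1 : (∏ t, openLink ρ β M (V (t - 1)) (V t) (Y t)) = ∏ t, gl t (Y t) := rfl
    rw [h1, hprod Y]
    simp only [hA1, hAG, hAF, hC, hAL, hAR, obsL, obsR, Sum.elim_inl, Sum.elim_inr, hσL, hσR']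
    ring
  simp_rw [hint]
  -- independence of (gap ⊔ far arc) from the two blocks
  have hσ1_inj : Function.Injective (Sum.elim σG σF) := fun a a' h =>
    Sum.inl_injective (hbij.1 (a₁ := Sum.inl a) (a₂ := Sum.inl a') h)
  have hσ2_inj : Function.Injective (Sum.elim σL σR) := fun c c' h =>
    Sum.inr_injective (hbij.1 (a₁ := Sum.inr c) (a₂ := Sum.inr c') h)
  have hdisj : ∀ a c, Sum.elim σG σF a ≠ Sum.elim σL σR c := fun a c h =>
    Sum.inl_ne_inr (hbij.1 (a₁ := Sum.inl a) (a₂ := Sum.inr c) h)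
  rw [integral_proj_mul_proj (halfHaar S G) hσ1_inj hσ2_inj hdisj hA1m hCm]
  -- independence gap / far arc and reflected / direct block
  have hA12 : ∫ z, A1 z ∂(Measure.pi fun _ : Fin s ⊕ Fin n => halfHaar S G) =
      (∫ y, AG y ∂(Measure.pi fun _ : Fin s => halfHaar S G)) * ∫ y, AF y ∂(Measure.pi fun _ : Fin n => halfHaar S G) := by
    simp only [hA1]
    exact integral_proj_mul_proj (halfHaar S G) (ι := Fin s ⊕ Fin n) Sum.inl_injective Sum.inr_injective
      (fun _ _ => Sum.inl_ne_inr) hAGm hAFm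
  have hC2 : ∫ z, C z ∂(Measure.pi fun _ : Fin (e + 1) ⊕ Fin (e + 1) => halfHaar S G) =
      (∫ y, AL y ∂(Measure.pi fun _ : Fin (e + 1) => halfHaar S G)) * ∫ y, AR y ∂(Measure.pi fun _ : Fin (e + 1) => halfHaar S G) := by
    simp only [hC]
    exact integral_proj_mul_proj (halfHaar S G) (ι := Fin (e + 1) ⊕ Fin (e + 1)) Sum.inl_injective Sum.inr_injective
      (fun _ _ => Sum.inl_ne_inr) hALm hARm
  rw [hA12, hC2]
  -- the gap: `s` reweighted lifted kernels
  have hGap : ∫ y, AG y ∂(Measure.pi fun _ : Fin s => halfHaar S G) =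
      ∏ j : Fin s, bKernel ρ β M (V (((j : ℕ) : ℕ) : ZMod m)) (V ((((j : ℕ) + 1 : ℕ)) : ZMod m)) := by
    simp only [hAG]
    rw [integral_fintype_prod_eq_prod]
    refine Finset.prod_congr rfl fun j _ => ?_
    simp only [hgl, hσG]
    rw [integral_openLink]
    congr 2
    push_cast
    ring
  -- the far arc: `n` reweighted lifted kernels
  have hFar : ∫ y, AF y ∂(Measure.pi fun _ : Fin n => halfHaar S G) =
      ∏ j : Fin n, bKernel ρ β M (V ((s + e + 1 + (j : ℕ) : ℕ) : ZMod m)) (V ((s + e + 2 + (j : ℕ) : ℕ) : ZMod m)) := by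
    simp only [hAF]
    rw [integral_fintype_prod_eq_prod]
    refine Finset.prod_congr rfl fun j _ => ?_
    simp only [hgl, hσF]
    rw [integral_openLink]
    congr 2
    push_cast
    ring
  -- the direct half block (on the shifted sites `V_s, …, V_{s+e+1}`)
  have hR : ∫ y, AR y ∂(Measure.pi fun _ : Fin (e + 1) => halfHaar S G) =
      halfBlock ρ β M g (fun j : Fin (e + 2) => V ((s + (j : ℕ) : ℕ) : ZMod m)) := by
    simp only [hAR, hgl, hσR]
    unfold halfBlock
    refine integral_congr_ae (ae_of_all _ fun y => ?_)
    have hidx : ∀ i : Fin (e + 1), (((s + (i : ℕ) + 1 : ℕ)) : ZMod m) = ((s + ((i.succ : Fin (e + 2)) : ℕ) : ℕ) : ZMod m) := fun i => by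
      rw [Fin.val_succ, Nat.add_assoc]
    have hidx' : ∀ i : Fin (e + 1), (((s + ((i.succ : Fin (e + 2)) : ℕ) : ℕ)) : ZMod m) - 1 =
        ((s + ((Fin.castSucc i : Fin (e + 2)) : ℕ) : ℕ) : ZMod m) := fun i => by
      rw [Fin.val_succ, Fin.val_castSucc]; push_cast; ring
    have hidx'' : ∀ i : Fin (e + 1), ((((i : ℕ) + 1 : ℕ)) : ZMod m) + (s : ZMod m) = ((s + ((i.succ : Fin (e + 2)) : ℕ) : ℕ) : ZMod m) :=
      fun i => by rw [Fin.val_succ]; push_cast; ring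
    simp only [hidx, hidx'']
    simp only [hidx']
  -- the reflected half block
  have hL : ∫ y, AL y ∂(Measure.pi fun _ : Fin (e + 1) => halfHaar S G) =
      halfBlock ρ β M f (fun j : Fin (e + 2) => V (-(((j : ℕ) : ℕ) : ZMod m))) := by
    simp only [hAL, hgl, hσL]
    rw [← integral_prod_openLink_thetaHalf_eq_halfBlock ρ β M f]
    refine integral_congr_ae (ae_of_all _ fun y => ?_)
    have hidx : ∀ i : Fin (e + 1), -(((i : ℕ) : ℕ) : ZMod m) - 1 = -(((i.succ : Fin (e + 2)) : ℕ) : ZMod m) := fun i => by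
      rw [Fin.val_succ]; push_cast; ring
    have hidx'' : ∀ i : Fin (e + 1), -((((i : ℕ) + 1 : ℕ)) : ZMod m) = -(((i.succ : Fin (e + 2)) : ℕ) : ZMod m) := fun i => by
      rw [Fin.val_succ]
    simp only [hidx, hidx'', Fin.val_castSucc]
  rw [hGap, hFar, hL, hR]

end ShiftedBlockChain

end Summit.QuantumFields.YangMills.Cruxes.DiagonalMirrorRPR.SignTwistedDiagonalTrace.WilsonDiagonal

end
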